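import Summits.QuantumAdvantage.QuantumAdvantage.Theorems.CubicForrelationNearExactIsExactCubicFormPairing
import Summits.QuantumAdvantage.QuantumAdvantage.Theorems.CubicForrelationNearExactIsExactTwelvePartnerLight
import Summits.QuantumAdvantage.QuantumAdvantage.Theorems.CubicForrelationNearExactIsExactTwelveDigitWeightReduction

/-!
# Crux `CubicForrelation.NearExactIsExact` (stmt-QuantumAdvantage-14043) — n = 12: `θ₁₂ = 57/64` FROM THE TWO PARTNER BRANCHES (R2, R4)

Certificate seat `b2b-cforr-cert` (gen 42).  HONEST FRAMING: kernel-checked packaging (standard axioms).  It composes the (L6) bridge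
(`tcp_pair`, `tcp_d_eq_third`: the cubic form of the digit class of a type-O cubic has a pairing partner — …CubicFormPairing), the top of the
partner route (`tpw_weight_ge_1280_of_branches` — …TwelvePartnerLight) and the window reduction (`theta_twelve_eq_57_64_of_digit_weight` —
…TwelveDigitWeightReduction).  CONDITIONAL on the branch statements `HR2` (R2-PARTNER.md + E1280-HANDPROOFS §1) and `HR4` (R4-PARTNER.md +
HANDPROOFS §2), which are NOT yet kernel theorems: θ₁₂ ∈ [57/64, 29/32) is formally unchanged.  NOT summit progress.

* `tpw_E1280_of_branches`: `HR2 ∧ HR4 ⇒ E1280` (every type-O cubic on 12 bits has digit class of size `≥ 1280`; both parities at once —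
  THEOREM W is not needed on this route, and neither is the no-period lemma).
* `theta_twelve_eq_57_64_of_branches`: `HR2 ∧ HR4 ⇒ θ₁₂ = 57/64`.

References: this seat lineage (g30 window pair, g33 reduction / dual form / pairing, g37 partner criterion, g39 hand proofs).  Axioms: the
standard three.
-/

set_option linter.dupNamespace false -- D-0017: single-problem summit ⇒ `QuantumAdvantage.QuantumAdvantage` by design

noncomputable section

namespace Summit.QuantumAdvantage.QuantumAdvantage.Theorems.CubicForrelation.NearExactIsExact

open Finset
open Literature.Computability.QuantumComplexity
open Literature.Computability.QuantumComplexity.BuzetChailloux (bxor zeroVec)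
open Literature.Computability.QuantumComplexity.DerivativeWalsh (W)

/-- **E1280 from the two partner branches.**  If `HR2` and `HR4` hold (see `tpw_weight_ge_1280_of_branches` for their exact statements),
then the digit class `{x : u(x) ≡ ±1 (mod 8)}` of every type-O cubic `g` on 12 bits (`W_g = 16u`, `u` odd) has at least `1280` points:
write `g = polyPhase p` (`deg p ≤ 3`), the digit class is cubic (`tdw_digitClass_cubic`), its cubic form is the matching dual `d`
(`tcp_d_eq_third`) and the monomial tensor `c` of `p` is a symmetric pairing partner (`tcp_pair`, `tcp_c_symm12/23`).
CONDITIONAL packaging; NOT summit progress. [this work] -/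
theorem tpw_E1280_of_branches
    (HR2 : ∀ (κ : (Fin (6 + 6) → Bool) → Bool), IsDegLeFun 3 κ →
      ∀ (c d : Fin (6 + 6) → Fin (6 + 6) → Fin (6 + 6) → ZMod 2),
      (∀ p j k, c p k j = c p j k) → (∀ p j k, c j p k = c p j k) → (∀ p j, c p j j = 0) →
      (∀ φ j k, d φ j k =
        if (((κ zeroVec ^^ κ (bxor zeroVec (fun l => decide (l = k)))) ^^
              (κ (bxor zeroVec (fun l => decide (l = j))) ^^ κ (bxor (bxor zeroVec (fun l => decide (l = j))) (fun l => decide (l = k))))) ^^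
            ((κ (bxor zeroVec (fun l => decide (l = φ))) ^^ κ (bxor (bxor zeroVec (fun l => decide (l = φ))) (fun l => decide (l = k)))) ^^
              (κ (bxor (bxor zeroVec (fun l => decide (l = φ))) (fun l => decide (l = j))) ^^
                κ (bxor (bxor (bxor zeroVec (fun l => decide (l = φ))) (fun l => decide (l = j))) (fun l => decide (l = k)))))) = true
        then 1 else 0) →
      (∀ p φ, (∑ j, ∑ k, (if j < k then c p j k * d φ j k else 0)) = if p = φ then 1 else 0) →
      ∀ a : Fin (6 + 6) → Bool, a ≠ zeroVec → #(univ.filter fun x => (κ x ^^ κ (bxor x a)) = true) = 1024 →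
      1280 ≤ #(univ.filter fun x : Fin (6 + 6) → Bool => κ x = true))
    (HR4 : ∀ (κ : (Fin (6 + 6) → Bool) → Bool), IsDegLeFun 3 κ →
      ∀ (c d : Fin (6 + 6) → Fin (6 + 6) → Fin (6 + 6) → ZMod 2),
      (∀ p j k, c p k j = c p j k) → (∀ p j k, c j p k = c p j k) → (∀ p j, c p j j = 0) →
      (∀ φ j k, d φ j k =
        if (((κ zeroVec ^^ κ (bxor zeroVec (fun l => decide (l = k)))) ^^
              (κ (bxor zeroVec (fun l => decide (l = j))) ^^ κ (bxor (bxor zeroVec (fun l => decide (l = j))) (fun l => decide (l = k))))) ^^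
            ((κ (bxor zeroVec (fun l => decide (l = φ))) ^^ κ (bxor (bxor zeroVec (fun l => decide (l = φ))) (fun l => decide (l = k)))) ^^
              (κ (bxor (bxor zeroVec (fun l => decide (l = φ))) (fun l => decide (l = j))) ^^
                κ (bxor (bxor (bxor zeroVec (fun l => decide (l = φ))) (fun l => decide (l = j))) (fun l => decide (l = k)))))) = true
        then 1 else 0) →
      (∀ p φ, (∑ j, ∑ k, (if j < k then c p j k * d φ j k else 0)) = if p = φ then 1 else 0) →
      ∀ a : Fin (6 + 6) → Bool, a ≠ zeroVec → #(univ.filter fun x => (κ x ^^ κ (bxor x a)) = true) = 1536 →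
      1280 ≤ #(univ.filter fun x : Fin (6 + 6) → Bool => κ x = true)) :
    ∀ (g : (Fin (6 + 6) → Bool) → Bool) (u : (Fin (6 + 6) → Bool) → ℤ), IsDegLeFun 3 g →
      (∀ x, W (fun y => signOf (g y)) x = (2 : ℝ) ^ 4 * (u x : ℝ)) → (∀ x, Odd (u x)) →
      1280 ≤ #(univ.filter fun x : Fin (6 + 6) → Bool => u x % 8 = 1 ∨ u x % 8 = 7) := by
  intro g u hg hu hodd
  have hQ := tdw_digitClass_cubic g u hg hu hodd
  obtain ⟨p, hp, hrep⟩ := hg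
  obtain ⟨c, hc⟩ : ∃ c : Fin (6 + 6) → Fin (6 + 6) → Fin (6 + 6) → ZMod 2, ∀ v j k, c v j k =
      ∑ s ∈ p.support, (if (v ≠ j ∧ v ≠ k ∧ j ≠ k ∧ s.support = {v, j, k}) then (1 : ZMod 2) else 0) :=
    ⟨_, fun _ _ _ => rfl⟩
  obtain ⟨d, hd⟩ : ∃ d : Fin (6 + 6) → Fin (6 + 6) → Fin (6 + 6) → ZMod 2, ∀ w j k, d w j k =
      if (w ≠ j ∧ w ≠ k ∧ j ≠ k) then
        ((#{S' ∈ p.support.powerset | #S' = 3 ∧ (S'.biUnion fun s => s.support) = ({w, j, k} : Finset _)ᶜ} : ℕ) : ZMod 2) else 0 :=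
    ⟨_, fun _ _ _ => rfl⟩
  have hcs : ∀ v j k, c v k j = c v j k := fun v j k => by rw [hc, hc]; exact tcp_c_symm23 p v j k
  have hcc : ∀ v j k, c j v k = c v j k := fun v j k => by rw [hc, hc]; exact tcp_c_symm12 p v j k
  have hcd : ∀ v j, c v j j = 0 := fun v j => by
    rw [hc]; exact Finset.sum_eq_zero fun s _ => if_neg fun h => h.2.2.1 rfl
  have hpair : ∀ v w, (∑ j, ∑ k, (if j < k then c v j k * d w j k else 0)) = if v = w then 1 else 0 := by
    intro v w
    simp only [hc, hd]
    exact tcp_pair p g u hp hrep hu hodd v w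
  have hset : (univ.filter fun x : Fin (6 + 6) → Bool => u x % 8 = 1 ∨ u x % 8 = 7) =
      univ.filter fun x : Fin (6 + 6) → Bool => decide (u x % 8 = 1 ∨ u x % 8 = 7) = true := by
    simp only [decide_eq_true_eq]
  rw [hset]
  refine tpw_weight_ge_1280_of_branches HR2 HR4 (fun x : Fin (6 + 6) → Bool => decide (u x % 8 = 1 ∨ u x % 8 = 7)) hQ
    c d hcs hcc hcd (fun w j k => ?_) hpair
  rw [hd]
  exact tcp_d_eq_third p g u hp hrep hu hodd w j k

/-- **`θ₁₂ = 57/64` from the two partner branches.**  `HR2 ∧ HR4 ⇒` the least `θ` isolating exactness of cubic pairs on 12 bits is `57/64`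
(`tpw_E1280_of_branches` + `theta_twelve_eq_57_64_of_digit_weight`).  CONDITIONAL packaging: `HR2`, `HR4` (the R2 and R4 halves of the partner
analysis) are not yet kernel theorems, so θ₁₂ ∈ [57/64, 29/32) is formally unchanged.  NOT summit progress. [this work] -/
theorem theta_twelve_eq_57_64_of_branches
    (HR2 : ∀ (κ : (Fin (6 + 6) → Bool) → Bool), IsDegLeFun 3 κ →
      ∀ (c d : Fin (6 + 6) → Fin (6 + 6) → Fin (6 + 6) → ZMod 2),
      (∀ p j k, c p k j = c p j k) → (∀ p j k, c j p k = c p j k) → (∀ p j, c p j j = 0) →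
      (∀ φ j k, d φ j k =
        if (((κ zeroVec ^^ κ (bxor zeroVec (fun l => decide (l = k)))) ^^
              (κ (bxor zeroVec (fun l => decide (l = j))) ^^ κ (bxor (bxor zeroVec (fun l => decide (l = j))) (fun l => decide (l = k))))) ^^
            ((κ (bxor zeroVec (fun l => decide (l = φ))) ^^ κ (bxor (bxor zeroVec (fun l => decide (l = φ))) (fun l => decide (l = k)))) ^^
              (κ (bxor (bxor zeroVec (fun l => decide (l = φ))) (fun l => decide (l = j))) ^^
                κ (bxor (bxor (bxor zeroVec (fun l => decide (l = φ))) (fun l => decide (l = j))) (fun l => decide (l = k)))))) = true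
        then 1 else 0) →
      (∀ p φ, (∑ j, ∑ k, (if j < k then c p j k * d φ j k else 0)) = if p = φ then 1 else 0) →
      ∀ a : Fin (6 + 6) → Bool, a ≠ zeroVec → #(univ.filter fun x => (κ x ^^ κ (bxor x a)) = true) = 1024 →
      1280 ≤ #(univ.filter fun x : Fin (6 + 6) → Bool => κ x = true))
    (HR4 : ∀ (κ : (Fin (6 + 6) → Bool) → Bool), IsDegLeFun 3 κ →
      ∀ (c d : Fin (6 + 6) → Fin (6 + 6) → Fin (6 + 6) → ZMod 2),
      (∀ p j k, c p k j = c p j k) → (∀ p j k, c j p k = c p j k) → (∀ p j, c p j j = 0) →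
      (∀ φ j k, d φ j k =
        if (((κ zeroVec ^^ κ (bxor zeroVec (fun l => decide (l = k)))) ^^
              (κ (bxor zeroVec (fun l => decide (l = j))) ^^ κ (bxor (bxor zeroVec (fun l => decide (l = j))) (fun l => decide (l = k))))) ^^
            ((κ (bxor zeroVec (fun l => decide (l = φ))) ^^ κ (bxor (bxor zeroVec (fun l => decide (l = φ))) (fun l => decide (l = k)))) ^^
              (κ (bxor (bxor zeroVec (fun l => decide (l = φ))) (fun l => decide (l = j))) ^^
                κ (bxor (bxor (bxor zeroVec (fun l => decide (l = φ))) (fun l => decide (l = j))) (fun l => decide (l = k)))))) = true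
        then 1 else 0) →
      (∀ p φ, (∑ j, ∑ k, (if j < k then c p j k * d φ j k else 0)) = if p = φ then 1 else 0) →
      ∀ a : Fin (6 + 6) → Bool, a ≠ zeroVec → #(univ.filter fun x => (κ x ^^ κ (bxor x a)) = true) = 1536 →
      1280 ≤ #(univ.filter fun x : Fin (6 + 6) → Bool => κ x = true)) :
    IsLeast {θ : ℝ | ∀ f g : (Fin 12 → Bool) → Bool, IsDegLeFun 3 f → IsDegLeFun 3 g →
      θ < forrelation f g → forrelation f g = 1} (57 / 64) :=
  theta_twelve_eq_57_64_of_digit_weight (tpw_E1280_of_branches HR2 HR4)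

end Summit.QuantumAdvantage.QuantumAdvantage.Theorems.CubicForrelation.NearExactIsExact

end
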